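import Literature.AlgebraicGeometry.Resolution.ParameterColonAnnihilator
import Literature.AlgebraicGeometry.Resolution.SecantSequenceLifts
import Literature.AlgebraicGeometry.Resolution.RegularLocalRingsProofs
import Mathlib.RingTheory.Depth.Rees
import HarnessLib

/-!
# Annihilation of parameter colon modules over a regular local ring

Topic: `Literature/AlgebraicGeometry/Resolution` (the Ext-annihilator form of Schenzel's theorem
[Schenzel1982, Satz 2.4.2] / [BrunsHerzog1998, Cor. 8.1.3 (b), Thm. 8.1.4] used for
Macaulayfication; assembled from `ParameterColonAnnihilator.lean` and `SecantSequenceLifts.lean`).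

Let `(S, 𝔪)` be a regular local ring of dimension `n`, `M ≠ 0` a finite `S`-module of dimension
`d`, `F` a free resolution of finite type of `M` with dual cohomology modules
`E^q = F.EMod q ≅ Ext^q_S(M, S)`, and put

`𝔠_F(M) = ∏_{n-d < q ≤ max(n,2)} Ann_S E^q`.

* `smul_mem_of_getElem_smul_mem_of_mem_prod_annihilator` — **Schenzel's annihilator theorem, Ext
  form**: for every secant sequence `r₁, …, r_s ∈ 𝔪` of `M` (e.g. part of a system of parameters),
  every `i < s` and every `c ∈ 𝔠_F(M)`: `c · ((r₁,…,rᵢ)M :_M r_{i+1}) ⊆ (r₁,…,rᵢ)M`.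

Proof (cf. [BrunsHerzog1998, 8.1.2–8.1.4] with `R = M` a module, [Schenzel1982, §2.4]): modify the
`rⱼ` modulo `Ann M` into an `S`-regular sequence `r'` (`exists_lift_secantSequence`; the colon
modules do not change); for `𝔵 = (r'₁,…,r'_{i+1})` the staircase hypothesis of
`FreeResolution.smul_mem_of_getElem_smul_mem` holds with `𝔞 q = S` for `q ≤ n - d` — because
`Ext^{q-1}_S(E^q, S/𝔵) = 0` by the Rees theorem (`Ann M`, which kills `E^q`, contains an
`S/𝔵`-regular sequence of length `n - d`, `exists_isWeaklyRegular_take_append`) — and with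
`𝔞 q = Ann E^q` for `q > n - d`; finally `pd_S M ≤ n` makes the boundary modules `B^q`, `q > n`,
projective.

[cite: Schenzel1982, Satz 2.4.2; BrunsHerzog1998, Cor. 8.1.3 (b), Thm. 8.1.4]
-/

noncomputable section

open CategoryTheory CategoryTheory.Abelian IsLocalRing Ideal Module RingTheory.Sequence

universe u

namespace Literature.AlgebraicGeometry.Resolution

variable {S : Type u} [CommRing S]

/-! ## Colon modules do not see `Ann M` -/

section Annihilator

variable {M : Type u} [AddCommGroup M] [Module S M]

/-- Sequences congruent modulo `Ann M` define the same submodules `(x₁,…,x_k)M`. [folklore] -/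
theorem ofList_smul_top_eq_of_sub_mem_annihilator {xs ys : List S} (hlen : xs.length = ys.length)
    (h : ∀ (i : ℕ) (hi : i < xs.length) (hi' : i < ys.length),
      xs[i] - ys[i] ∈ Module.annihilator S M) :
    (ofList xs • ⊤ : Submodule S M) = ofList ys • ⊤ := by
  have key : ∀ I : Ideal S, (I • ⊤ : Submodule S M) = (Module.annihilator S M ⊔ I) • ⊤ := by
    intro I
    rw [Submodule.sup_smul, ← Submodule.annihilator_top, Submodule.annihilator_smul, bot_sup_eq]
  rw [key, key (ofList ys), sup_ofList_eq_of_sub_mem _ hlen h]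

/-- Elements congruent modulo `Ann M` act in the same way. [folklore] -/
theorem smul_eq_smul_of_sub_mem_annihilator {x y : S} (h : x - y ∈ Module.annihilator S M)
    (m : M) : x • m = y • m := by
  rw [← sub_eq_zero, ← sub_smul]
  exact Module.mem_annihilator.mp h m

/-- `I · (S/J) ≠ S/J` for proper ideals `I, J` of a local ring (Nakayama). [folklore] -/
theorem smul_top_ne_top_of_le_maximalIdeal [IsLocalRing S] {I J : Ideal S}
    (hI : I ≤ maximalIdeal S) (hJ : J ≤ maximalIdeal S) :
    (I • ⊤ : Submodule S (S ⧸ J)) ≠ ⊤ := by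
  have hJtop : J ≠ ⊤ := fun h => (maximalIdeal.isMaximal S).ne_top (top_le_iff.mp (h ▸ hJ))
  haveI : Nontrivial (S ⧸ J) := Ideal.Quotient.nontrivial_iff.mpr hJtop
  refine (Submodule.top_ne_ideal_smul_of_le_jacobson_annihilator ?_).symm
  rw [IsLocalRing.jacobson_eq_maximalIdeal _ fun h => ?_]
  · exact hI
  · have h1 := Module.mem_annihilator.mp
      (show (1 : S) ∈ Module.annihilator S (S ⧸ J) from h ▸ Submodule.mem_top) 1
    rw [one_smul] at h1
    exact one_ne_zero h1

end Annihilator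

/-! ## The annihilator theorem -/

section Regular

variable [IsRegularLocalRing S]
variable {M : Type u} [AddCommGroup M] [Module S M] [Module.Finite S M] [Nontrivial M]

/-- **Schenzel's annihilator theorem, Ext form** ([Schenzel1982, Satz 2.4.2];
[BrunsHerzog1998, Cor. 8.1.3 (b) with Thm. 8.1.4], for a module over a regular local ring and with
the annihilators of `Ext^q_S(M, S)`, `q > n - d`, in place of those of local cohomology): let `S`
be regular local of dimension `n`, `M ≠ 0` finite of dimension `d` with a free resolution of finite
type `F` (`E^q = F.EMod q ≅ Ext^q_S(M,S)`), `r₁, …, r_s ∈ 𝔪` a secant sequence for `M` and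
`i < s`. Then every `c ∈ ∏_{n-d < q ≤ max(n,2)} Ann_S E^q` satisfies
`c · ((r₁,…,rᵢ)M :_M r_{i+1}) ⊆ (r₁,…,rᵢ)M`.
[cite: Schenzel1982, Satz 2.4.2; BrunsHerzog1998, Cor. 8.1.3 (b)] -/
theorem smul_mem_of_getElem_smul_mem_of_mem_prod_annihilator (F : FreeResolution S M) {n d : ℕ}
    (hn : ringKrullDim S = n) (hd : Module.supportDim S M = d)
    {rs : List S} (hrs : IsSecantSequence M rs) (hmem : ∀ r ∈ rs, r ∈ maximalIdeal S)
    {i : ℕ} (hi : i < rs.length) {c : S}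
    (hc : c ∈ ∏ q ∈ Finset.Ioc (n - d) (max n 2), Module.annihilator S (F.EMod q))
    {m : M} (hm : rs[i] • m ∈ (ofList (rs.take i) • ⊤ : Submodule S M)) :
    c • m ∈ (ofList (rs.take i) • ⊤ : Submodule S M) := by
  classical
  -- Step 1: replace `rs` by an `S`-regular sequence `rs'` congruent modulo `Ann M`
  obtain ⟨rs', hlen, hcongr, hmem', hht⟩ := exists_lift_secantSequence (M := M) hrs hmem
  have hi' : i < rs'.length := hlen ▸ hi
  have hreg' : IsWeaklyRegular S rs' := by
    refine isWeaklyRegular_of_length_le_height hmem' ?_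
    have h0 := hht rs'.length le_rfl
    rwa [List.take_length] at h0
  have htake : ∀ k, (ofList (rs'.take k) • ⊤ : Submodule S M) = ofList (rs.take k) • ⊤ := by
    intro k
    refine ofList_smul_top_eq_of_sub_mem_annihilator (by rw [List.length_take, List.length_take, hlen]) ?_
    intro j hj hj'
    rw [List.getElem_take, List.getElem_take]
    rw [List.length_take] at hj hj'
    exact hcongr j (by omega) (by omega)
  have hm' : rs'[i] • m ∈ (ofList (rs'.take i) • ⊤ : Submodule S M) := by
    rw [htake i, smul_eq_smul_of_sub_mem_annihilator (hcongr i hi' hi) m]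
    exact hm
  rw [← htake i]
  -- the ideal `𝔵 = (r'₁, …, r'_{i+1})`
  set J : Ideal S := ofList (rs'.take (i + 1)) with hJ
  have hJm : J ≤ maximalIdeal S :=
    Ideal.span_le.mpr fun r hr => hmem' r (List.mem_of_mem_take hr)
  have hAnn : Module.annihilator S M ≤ maximalIdeal S := annihilator_le_maximalIdeal M
  -- Step 2: an `S/𝔵`-regular sequence `ys ⊆ Ann M` of length `n - d`
  obtain ⟨ys, hylen, hymem, hyreg⟩ := exists_isWeaklyRegular_take_append (M := M) hrs hmem hlen
    hcongr hmem' (k := i + 1) hi (hht (i + 1) (Nat.succ_le_of_lt hi')) hn hd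
  let Q : ModuleCat.{u} S := ModuleCat.of S (S ⧸ J)
  have hyregQ : IsWeaklyRegular Q ys := by
    have h1 := ((isWeaklyRegular_append_iff S (rs'.take (i + 1)) ys).mp hyreg).2
    have e : (S ⧸ (ofList (rs'.take (i + 1)) • ⊤ : Submodule S S)) ≃ₗ[S] S ⧸ J :=
      Submodule.quotEquivOfEq _ _ (by rw [hJ, smul_eq_mul, Ideal.mul_top])
    exact (e.isWeaklyRegular_congr ys).mp h1
  have hyregQ' : IsRegular Q ys := by
    refine ⟨hyregQ, ?_⟩
    change (⊤ : Submodule S (S ⧸ J)) ≠ ofList ys • ⊤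
    exact (smul_top_ne_top_of_le_maximalIdeal
      (Ideal.span_le.mpr fun y hy => hAnn (hymem y hy)) hJm).symm
  have smul_lt : Module.annihilator S M • (⊤ : Submodule S Q) < ⊤ :=
    (smul_top_ne_top_of_le_maximalIdeal (J := J) hAnn hJm).lt_top
  -- Step 3: the staircase ideals
  let 𝔞 : ℕ → Ideal S := fun q => if q ≤ n - d then 1 else Module.annihilator S (F.EMod q)
  set N : ℕ := max n 2 with hN
  have hN2 : 2 ≤ N := le_max_right _ _
  have hc' : c ∈ ∏ t ∈ Finset.Ico 1 (N + 1), 𝔞 t := by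
    have h𝔞 : ∏ t ∈ Finset.Ico 1 (N + 1), 𝔞 t =
        ∏ q ∈ Finset.Ioc (n - d) N, Module.annihilator S (F.EMod q) := by
      rw [Finset.prod_ite, Finset.prod_const_one, one_mul]
      refine Finset.prod_congr ?_ fun _ _ => rfl
      ext t
      simp only [Finset.mem_filter, Finset.mem_Ico, Finset.mem_Ioc, not_le]
      omega
    rw [h𝔞]
    exact hc
  -- Step 4: the staircase hypothesis
  have h : ∀ q d' : ℕ, 1 ≤ q → d' + 1 = q →
      (∀ a ∈ 𝔞 q, ∀ e : F.staircase.E q, a • e = 0) ∨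
        (∀ x : Ext.{u} (F.staircase.E q) (ModuleCat.of S (S ⧸ ofList (rs'.take (i + 1)))) d',
          x = 0) := by
    intro q d' _ hd'q
    by_cases hqg : q ≤ n - d
    · right
      intro x
      have Nsupp : Module.support S (ModuleCat.of S (F.EMod q)) ⊆
          PrimeSpectrum.zeroLocus (Module.annihilator S M) := by
        change Module.support S (F.EMod q) ⊆ _
        rw [Module.support_eq_zeroLocus]
        exact PrimeSpectrum.zeroLocus_anti_mono
          (show ((Module.annihilator S M : Ideal S) : Set S) ⊆ Module.annihilator S (F.EMod q) from
            fun a ha => Module.mem_annihilator.mpr (F.smul_EMod_eq_zero_of_mem_annihilator ha q))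
      have hsub : Subsingleton (Ext.{u} (ModuleCat.of S (F.EMod q)) Q d') :=
        ModuleCat.subsingleton_ext_of_exists_isRegular (Module.annihilator S M)
          (ModuleCat.of S (F.EMod q)) Nsupp Q smul_lt ys hymem hyregQ' d' (by omega)
      exact hsub.elim _ _
    · left
      intro a ha e
      have ha' : a ∈ Module.annihilator S (F.EMod q) := by
        simp only [𝔞, if_neg hqg] at ha
        exact ha
      exact Module.mem_annihilator.mp ha' e
  -- Step 5: `pd_S M ≤ n`, so `B^q` is projective for `q > N ≥ n`
  have hB : ∀ q, N < q → Projective (F.staircase.B q) := by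
    obtain ⟨xs, hxreg, hxspan, hxlen⟩ := exists_isRegular_ofList_eq_maximalIdeal (R := S)
    have hpd := hasProjectiveDimensionLE_length_of_isWeaklyRegular hxreg.toIsWeaklyRegular hxspan
      (ModuleCat.of S M)
    have hxn : xs.length = n := by
      rw [hn] at hxlen
      exact_mod_cast hxlen
    rw [hxn] at hpd
    intro q hq
    exact F.projective_B_of_hasProjectiveDimensionLE hpd q (lt_of_le_of_lt (le_max_left n 2) hq)
  -- Step 6: the colon statement for the regular lift `rs'`
  exact F.smul_mem_of_getElem_smul_mem rs' hreg' hi' 𝔞 N hN2 h hB hc' hm'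

end Regular

end Literature.AlgebraicGeometry.Resolution

end
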